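import Summits.CriticalPhenomena.CardyFormulaZ2.Theorems.CardyDualCurrentMartingaleToSLE6StubPercFaceBoxTight2
import Summits.CriticalPhenomena.CardyFormulaZ2.Theorems.ParafermionPrecompact.Negative.ParafermionPrecompactFalseOfBulkNondegenerate
import Literature.Probability.LatticeModels.ExplorationWinding
import Literature.Probability.RandomPlanarGeometry.PolylineUniform
import Literature.Probability.RandomPlanarGeometry.PolylineDyadicClock
import HarnessLib

/-!
# Stub `stub_percFaceBoxTight` (crux stmt-CriticalPhenomena-11395, line `registered`), III:
# at a fixed mesh the raw interface is a polyline whose open corner cuts lie in the face domain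

Route `CardyDualCurrent`, crux `…Theses.CardyDualCurrent.MartingaleToSLE6`, stub S1
`stub_percFaceBoxTight : PercFaceBoxTight`. Sequel of `…StubPercFaceBoxTight2.lean` (p169112),
which reduced the per-scale half of the stub to (iv′): at each positive admissible mesh, through
every chordal `ψ` of the oriented face domain, `Pc`-a.e. `IsLoewnerDescribable ψ (bondInterfaceIn
D (Λ δ) ω)` (`percFaceBoxTight_of_conditionG2_of_describable`; necessary by
`ae_isLoewnerDescribable_of_percFaceBoxTight`). This file PROVES the first deterministic layer
(H1) of (iv′), for EVERY configuration `ω`, in the oriented face domain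
`(D_δ; pt 0, pt 1) := orientedFaceDomain hΛ hadm`:

* `openSegment_medialPoint_subset_cell` — the open corner cut of a medial edge lies in the open
  cell of its face; with `W_bcycle_cFace_cornerOrbit` (explored faces have winding number one)
  and `cell_subset_faceDomain_of_W_ne_zero`: **every open medial edge of the exploration lies in
  the OPEN carrier** (`openSegment_cornerOrbit_subset_faceDomain`);
* `cornerOrbit_fst_not_mem_zdArcB` (the left vertex is never a `B`-site), whence `e_a` is visited
  only at time `0` and `e_b` only at the exit time (`cSrc_cornerOrbit_ne_cSrc_start`,
  `cSrc_cornerOrbit_ne_cSrc_of_exit`; medial points separate lattice edges,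
  `medialPoint_injOn_edgeSet`): **no interior vertex of the polyline is `pt 0` or `pt 1`**;
* **`bondInterfaceIn_polylineData`** (registered helper) — `bondInterfaceIn D (Λ δ) ω = ⟦polyline L⟧`
  for an explicit vertex list `L` (midpoints of the medial vertices, reversed exactly when the
  endpoint rule `orientCurve D` reverses the curve, `Polyline.reverse_mk_polyline`) running from
  `pt 0` to `pt 1` in `closure D_δ`, with open segments in `D_δ`, interior vertices off the marked
  points, consecutive vertices distinct, and every point of the trace in `D_δ` or a vertex
  (`polyline_apply_mem_or_mem`): the interface meets `∂D_δ` in finitely many POINTS (the marked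
  points and midpoints of face-boundary edges followed inside their face) and reaches `b_δ` only
  at its last vertex.

Not here (the remaining layers of (iv′)): non-self-traversal of the polyline (its future stays in
the closure of the component of `D_δ ∖ past` adjacent to `b_δ`) and Loewner's theorem for such a
curve pulled back by `ψ` (the tree has it for simple slits only, `SlitLoewnerChain.lean`,
`SimpleCurveLoewner.lean`).

References: S. Smirnov, C. R. Acad. Sci. Paris 333 (2001), §2 [Smirnov2001]; D. Chelkak,
H. Duminil-Copin, C. Hongler, A. Kemppainen, S. Smirnov, C. R. Math. 352 (2014), §2 (the polygonal
domain `Ω^δ_ℂ`) [CDHKSCRAS2014]; A. Kemppainen, S. Smirnov, Ann. Probab. 45 (2017), §1.1, §4.1.4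
(the interface as a curve of `(D_δ; a_δ, b_δ)` touching `∂D_δ` and itself) [KemppainenSmirnov2017].
(buildfix 2026-08-20: comment-only re-land to re-enqueue the module build after its blocking imports were repaired; no declaration changed.)
-/

noncomputable section

open scoped unitInterval
open Set Literature.Probability Literature.Probability.LatticeModels Literature.Probability.Percolation
open Literature.Probability.LatticeModels.DiscreteDobrushin Literature.Probability.RandomPlanarGeometry

namespace Summit.CriticalPhenomena.CardyFormulaZ2.Cruxes.MartingaleToSLE6.Birth

open Summit.CriticalPhenomena.CardyFormulaZ2.Theorems.ParafermionPrecompact.Negative (medialPoint_injOn_edgeSet)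

/-! ### Lattice geometry: the corner cut of a medial edge runs inside the open cell of its face -/

/-- **The open corner cut lies in the open cell.** For a coded corner `p = (v, k)` the open
segment joining the midpoints of its source edge `cSrc p` and its target edge `cTgt p` (two
perpendicular sides of the face `cFace p` at `v`) lies in the open cell of `cFace p`.
[cite: Smirnov2001, §2] -/
theorem openSegment_medialPoint_subset_cell {δ : ℝ} (hδ : 0 < δ) (p : Site 2 × Fin 4) :
    openSegment ℝ (medialPoint δ (cSrc p)) (medialPoint δ (cTgt p)) ⊆
      Mesh.cell δ ((cFace p) 0) ((cFace p) 1) := by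
  rintro z ⟨a, b, ha, hb, hab, rfl⟩
  obtain rfl : b = 1 - a := by linarith
  obtain ⟨v, k⟩ := p
  rw [medialPoint_cSrc, medialPoint_cTgt, Mesh.mem_cell_iff]
  simp only [cFace, faceAt]
  fin_cases k <;>
    simp [cornerOff, meshPoint_re, meshPoint_im, pow_succ] <;>
    refine ⟨⟨?_, ?_⟩, ?_, ?_⟩ <;> nlinarith [mul_pos ha hδ, mul_pos hb hδ]

/-! ### The orbit: the left vertex is never a `B`-site; `e_a` and `e_b` are visited once -/

section Orbit

variable {E : DiscreteDobrushin} {ω : BondConfig (Site 2)} {c₀ : Site 2 × Fin 4}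

/-- **The left vertex of the exploration is never on the arc `B`**: it lies on the arc `A` or on
an open edge of the completed configuration (`cornerOrbit_inv`), and edges at `B`-sites are closed.
[cite: Smirnov2001, §2] -/
theorem cornerOrbit_fst_not_mem_zdArcB (hE : E.IsZdAdmissible) (hc₀ : E.IsStartCorner c₀) (n : ℕ) :
    (cornerOrbit (E.bcBondConfig ω) c₀ n).1 ∉ E.zdArcB := by
  intro hB
  rcases cornerOrbit_inv (ω := ω) hc₀ n with hA | ⟨e, he, hxe⟩
  · exact Set.disjoint_left.1 hE.disjoint hA hB
  · exact not_mem_bcBondConfig_of_mem_zdArcB hE hxe hB he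

/-- **The start edge `e_a` is visited only at time `0`**: while the faces are inner, the source
edge of the `n`-th corner, `n > 0`, is not `e_a` (with the same orientation the orbit would be
back at the start corner, `cornerOrbit_ne`; with the opposite one its left vertex would be the
`B`-end of `e_a`). [cite: Smirnov2001, §2] -/
theorem cSrc_cornerOrbit_ne_cSrc_start (hE : E.IsZdAdmissible) (hc₀ : E.IsStartCorner c₀) {n : ℕ}
    (hn : 0 < n) (hinner : ∀ k < n, E.IsInnerFace (cFace (cornerOrbit (E.bcBondConfig ω) c₀ k))) :
    cSrc (cornerOrbit (E.bcBondConfig ω) c₀ n) ≠ cSrc c₀ := by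
  intro h
  rw [cSrc, cSrc, Sym2.eq_iff] at h
  rcases h with ⟨h1, h2⟩ | ⟨h1, -⟩
  · rw [h1] at h2
    exact cornerOrbit_ne hE hc₀ hn hinner
      (Prod.ext h1 (cornerUnit_injective (add_left_cancel h2)) : _ = c₀).symm
  · exact cornerOrbit_fst_not_mem_zdArcB hE hc₀ n (by rw [h1]; exact hc₀.mem_zdArcB)

/-- **The exit edge `e_b` is visited only at the exit time**: if the faces are inner before `N`
and the `N`-th is not, the source edge of the `n`-th corner, `n < N`, is not that of the `N`-th
(the exit corner is reached across the closed `A`–`B` edge `e_b`, `cornerOrbit_exit`, whose far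
end is a `B`-site). [cite: Smirnov2001, §2] -/
theorem cSrc_cornerOrbit_ne_cSrc_of_exit (hE : E.IsZdAdmissible) (hc₀ : E.IsStartCorner c₀)
    {n N : ℕ} (hnN : n < N)
    (hinner : ∀ k < N, E.IsInnerFace (cFace (cornerOrbit (E.bcBondConfig ω) c₀ k)))
    (hout : ¬ E.IsInnerFace (cFace (cornerOrbit (E.bcBondConfig ω) c₀ N))) :
    cSrc (cornerOrbit (E.bcBondConfig ω) c₀ n) ≠ cSrc (cornerOrbit (E.bcBondConfig ω) c₀ N) := by
  obtain ⟨M, rfl⟩ : ∃ M, N = M + 1 := ⟨N - 1, by omega⟩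
  obtain ⟨hclosed, -, hB, -⟩ := cornerOrbit_exit hE hc₀ (hinner M (Nat.lt_succ_self M)) hout
  have hnext : cornerOrbit (E.bcBondConfig ω) c₀ (M + 1) =
      ((cornerOrbit (E.bcBondConfig ω) c₀ M).1, (cornerOrbit (E.bcBondConfig ω) c₀ M).2 + 1) := by
    rw [cornerOrbit_succ, nextCorner_of_not_mem hclosed]
  intro h
  rw [hnext, cSrc, cSrc, Sym2.eq_iff] at h
  rcases h with ⟨h1, h2⟩ | ⟨h1, -⟩
  · rw [h1] at h2
    refine cornerOrbit_ne hE hc₀ hnN hinner ?_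
    rw [hnext]
    exact Prod.ext h1 (cornerUnit_injective (add_left_cancel h2))
  · exact cornerOrbit_fst_not_mem_zdArcB hE hc₀ n (by rw [h1]; exact hB)

end Orbit

/-! ### In the face domain of a regular admissible datum -/

section Regular

variable {E : DiscreteDobrushin} (hE : E.IsZdAdmissible) (hΩo : IsOpen E.Ω)
  (hext : IsConnected (closure E.Ω)ᶜ) (hunb : ¬ Bornology.IsBounded (closure E.Ω)ᶜ)
  (hfr : frontier E.Ω ⊆ closure (closure E.Ω)ᶜ)

/-- **The open medial edges of the exploration lie in the OPEN face domain**: the `n`-th medial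
edge (`n < exitTime`) is the corner cut of the explored inner face `cFace (orbit n)`, its interior
lies in the open cell of that face, and the cell lies in the face domain because the face has
winding number one for the boundary cycle. [cite: CDHKSCRAS2014, §2] -/
theorem openSegment_cornerOrbit_subset_faceDomain (ω : BondConfig (Site 2)) {n : ℕ}
    (hn : n < exitTime hE ω) :
    openSegment ℝ (medialPoint E.δ (cSrc (cornerOrbit (E.bcBondConfig ω) (startCorner hE) n)))
        (medialPoint E.δ (cSrc (cornerOrbit (E.bcBondConfig ω) (startCorner hE) (n + 1)))) ⊆
      (faceDomain hE hΩo hext hunb hfr).carrier := by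
  rw [cSrc_cornerOrbit_succ]
  refine (openSegment_medialPoint_subset_cell hE.delta_pos _).trans ?_
  exact cell_subset_faceDomain_of_W_ne_zero hE hΩo hext hunb hfr
    (by rw [W_bcycle_cFace_cornerOrbit hE hΩo hext hunb hfr ω hn]; exact one_ne_zero)

/-- **`a_δ` is not revisited**: the `n`-th medial vertex, `0 < n ≤ exitTime`, is not the marked
point `pt 0 = a_δ` (midpoint of `e_a`) of the face domain. [cite: Smirnov2001, §2] -/
theorem medialPoint_cornerOrbit_ne_pt_zero (ω : BondConfig (Site 2)) {n : ℕ} (hn0 : 0 < n)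
    (hn : n ≤ exitTime hE ω) :
    medialPoint E.δ (cSrc (cornerOrbit (E.bcBondConfig ω) (startCorner hE) n)) ≠
      (faceDomain hE hΩo hext hunb hfr).pt 0 := by
  rw [faceDomain_pt_zero]
  intro h
  exact cSrc_cornerOrbit_ne_cSrc_start hE (isStartCorner_startCorner hE) hn0
    (fun k hk ↦ isInnerFace_of_lt_exitTime hE ω (lt_of_lt_of_le hk hn))
    (medialPoint_injOn_edgeSet hE.delta_pos.ne' (cSrc_mem_edgeSet _) (cSrc_mem_edgeSet _) h)

/-- **`b_δ` is reached only at the end**: the `n`-th medial vertex, `n < exitTime`, is not the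
marked point `pt 1 = b_δ` (midpoint of `e_b`) of the face domain. [cite: Smirnov2001, §2] -/
theorem medialPoint_cornerOrbit_ne_pt_one (ω : BondConfig (Site 2)) {n : ℕ}
    (hn : n < exitTime hE ω) :
    medialPoint E.δ (cSrc (cornerOrbit (E.bcBondConfig ω) (startCorner hE) n)) ≠
      (faceDomain hE hΩo hext hunb hfr).pt 1 := by
  rw [faceDomain_pt_one, ← ebDart'_eq_ebDart hE ω, cSrc_ebDart', lastCorner, ← cSrc_cornerOrbit_succ,
    Nat.sub_add_cancel (exitTime_pos hE ω)]
  intro h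
  exact cSrc_cornerOrbit_ne_cSrc_of_exit hE (isStartCorner_startCorner hE) hn
    (fun k hk ↦ isInnerFace_of_lt_exitTime hE ω hk) (not_isInnerFace_exitTime hE ω)
    (medialPoint_injOn_edgeSet hE.delta_pos.ne' (cSrc_mem_edgeSet _) (cSrc_mem_edgeSet _) h)

/-- Consecutive medial vertices of the exploration have distinct midpoints. [folklore] -/
theorem medialPoint_cornerOrbit_ne_succ (ω : BondConfig (Site 2)) (n : ℕ) :
    medialPoint E.δ (cSrc (cornerOrbit (E.bcBondConfig ω) (startCorner hE) n)) ≠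
      medialPoint E.δ (cSrc (cornerOrbit (E.bcBondConfig ω) (startCorner hE) (n + 1))) := by
  intro h
  have h' := medialPoint_injOn_edgeSet hE.delta_pos.ne' (cSrc_mem_edgeSet _) (cSrc_mem_edgeSet _) h
  rw [cSrc_cornerOrbit_succ] at h'
  -- source and target of a corner differ (`eq_of_sym2_add_eq`)
  exact absurd (cornerUnit_injective (eq_of_sym2_add_eq h')) (by simp)

end Regular

/-! ### Polylines whose open segments lie in a set -/

/-- **A polyline whose open segments lie in `C` meets `Cᶜ` only at its vertices**: every point of
`polyline L` lies in `C` or is a vertex of `L` (dyadic clock, `polylineFrom_apply_mem_segment_segIdx`;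
on the terminal rest interval the polyline sits at the last vertex). [folklore] -/
theorem polyline_apply_mem_or_mem {V : Type*} [NormedAddCommGroup V] [NormedSpace ℝ V]
    {C : Set V} {L : List V} (hL : L ≠ [])
    (h : ∀ (i : ℕ) (hi : i + 1 < L.length), openSegment ℝ L[i] L[i + 1] ⊆ C) (s : I) :
    polyline L s ∈ C ∨ polyline L s ∈ L := by
  classical
  obtain ⟨a, l, rfl⟩ := List.exists_cons_of_ne_nil hL
  change (polylineFrom a l).2 s ∈ C ∨ (polylineFrom a l).2 s ∈ a :: l
  rcases (segIdx_le l.length s).lt_or_eq with hlt | heq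
  · have hmem := polylineFrom_apply_mem_segment_segIdx a l s hlt
    rw [← insert_endpoints_openSegment] at hmem
    rcases hmem with h1 | h1 | h1
    · exact Or.inr (h1 ▸ List.getElem_mem _)
    · exact Or.inr (h1 ▸ List.getElem_mem _)
    · exact Or.inl (h _ (by simpa using hlt) h1)
  · rw [polylineFrom_apply_of_segIdx_eq a l s heq]
    exact Or.inr (List.getElem_mem _)

/-! ### The interface of a discretisation family at a fixed admissible mesh -/

section Family

variable {D : DobrushinDomain} {Λ : ℝ → DiscreteDobrushin} (hΛ : ZdDiscretisationFamily D Λ)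
  {δ : ℝ} (hadm : (Λ δ).IsZdAdmissible)

include hΛ in
/-- The exploration curve of the datum `Λ δ` is the polyline through the midpoints of the sources
of the orbit corners up to the exit time (`medialExploration_map_eq` with `(Λ δ).δ = δ`).
[cite: Smirnov2001, §2] -/
theorem medialExplorationCurve_eq_polyline (ω : BondConfig (Site 2)) :
    medialExplorationCurve (Λ δ) ω = polyline ((List.range (exitTime hadm ω + 1)).map
      fun i ↦ medialPoint δ (cSrc (cornerOrbit ((Λ δ).bcBondConfig ω) (startCorner hadm) i))) := by
  rw [medialExplorationCurve, medialExploration_map_eq hadm, hΛ.δ_eq δ]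

end Family

/-- **(H1) The raw interface at a fixed admissible mesh is an explicit polyline with open
segments in the oriented face domain.** For every Dobrushin domain `D`, family `Λ`, admissible
mesh `δ` and EVERY configuration `ω` there is a vertex list `L` (the midpoints of the medial
vertices of the exploration of `ω`, reversed exactly when the endpoint rule `orientCurve D`
reverses the polyline) with: `bondInterfaceIn D (Λ δ) ω = ⟦polyline L⟧`; `L` runs from `pt 0` to
`pt 1` of `D_δ := orientedFaceDomain hΛ hadm`; all vertices lie in `closure D_δ`; every OPEN
segment `]L[i], L[i+1][` lies in the open carrier `D_δ`; no interior vertex is `pt 0` or `pt 1`;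
consecutive vertices are distinct. (Smirnov 2001 §2; CDHKS 2014 §2; Kemppainen–Smirnov 2017
§1.1, §4.1.4: the interface as a curve of the polygonal domain touching `∂D_δ` and itself only at
medial vertices.) [cite: KemppainenSmirnov2017, §1.1 and §4.1.4] -/
theorem bondInterfaceIn_polylineData : ∀ (D : DobrushinDomain) (Λ : ℝ → DiscreteDobrushin)
    (hΛ : ZdDiscretisationFamily D Λ) (δ : ℝ) (hadm : (Λ δ).IsZdAdmissible) (ω : BondConfig (Site 2)),
    ∃ L : List ℂ, 2 ≤ L.length ∧
      Literature.Probability.Percolation.bondInterfaceIn D (Λ δ) ω = CurveClass.mk ⟨polyline L⟩ ∧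
      L.head? = some ((orientedFaceDomain hΛ hadm).pt 0) ∧
      L.getLast? = some ((orientedFaceDomain hΛ hadm).pt 1) ∧
      (∀ p ∈ L, p ∈ closure (orientedFaceDomain hΛ hadm).carrier) ∧
      (∀ (i : ℕ) (hi : i + 1 < L.length),
        openSegment ℝ L[i] L[i + 1] ⊆ (orientedFaceDomain hΛ hadm).carrier) ∧
      (∀ (i : ℕ) (hi : i + 1 < L.length), 0 < i →
        L[i] ≠ (orientedFaceDomain hΛ hadm).pt 0 ∧ L[i] ≠ (orientedFaceDomain hΛ hadm).pt 1) ∧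
      (∀ (i : ℕ) (hi : i + 1 < L.length), L[i] ≠ L[i + 1]) ∧
      (∀ s : I, polyline L s ∈ (orientedFaceDomain hΛ hadm).carrier ∨ polyline L s ∈ L) := by
  intro D Λ hΛ δ hadm ω
  classical
  -- it suffices to produce the list without the last clause (`polyline_apply_mem_or_mem`)
  suffices H : ∃ L : List ℂ, 2 ≤ L.length ∧
      Literature.Probability.Percolation.bondInterfaceIn D (Λ δ) ω = CurveClass.mk ⟨polyline L⟩ ∧
      L.head? = some ((orientedFaceDomain hΛ hadm).pt 0) ∧
      L.getLast? = some ((orientedFaceDomain hΛ hadm).pt 1) ∧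
      (∀ p ∈ L, p ∈ closure (orientedFaceDomain hΛ hadm).carrier) ∧
      (∀ (i : ℕ) (hi : i + 1 < L.length),
        openSegment ℝ L[i] L[i + 1] ⊆ (orientedFaceDomain hΛ hadm).carrier) ∧
      (∀ (i : ℕ) (hi : i + 1 < L.length), 0 < i →
        L[i] ≠ (orientedFaceDomain hΛ hadm).pt 0 ∧ L[i] ≠ (orientedFaceDomain hΛ hadm).pt 1) ∧
      (∀ (i : ℕ) (hi : i + 1 < L.length), L[i] ≠ L[i + 1]) by
    obtain ⟨L, h2, hI, hh, hl, hcl, hseg, hmark, hsucc⟩ := H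
    exact ⟨L, h2, hI, hh, hl, hcl, hseg, hmark, hsucc,
      polyline_apply_mem_or_mem (List.ne_nil_of_length_pos (by omega)) hseg⟩
  -- the unoriented vertex list and its properties in the (unoriented) face domain
  set N := exitTime hadm ω
  set g : ℕ → ℂ := fun i ↦ medialPoint δ (cSrc (cornerOrbit ((Λ δ).bcBondConfig ω) (startCorner hadm) i))
  set L₀ : List ℂ := (List.range (N + 1)).map g with hL₀
  obtain ⟨hΩo, hext, hunb, hfr⟩ := regular_of_zdDiscretisationFamily hΛ δ
  have hδE : (Λ δ).δ = δ := hΛ.δ_eq δ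
  have hlen : L₀.length = N + 1 := by simp [hL₀]
  have hget : ∀ (i : ℕ) (hi : i < L₀.length), L₀[i] = g i := fun i hi ↦ by simp [hL₀]
  have hcurve : medialExplorationCurve (Λ δ) ω = polyline L₀ := medialExplorationCurve_eq_polyline hΛ hadm ω
  have hF0 : (familyFaceDomain hΛ hadm).pt 0 = g 0 := by
    rw [← medialExplorationCurve_apply_zero_eq hΛ hadm ω, hcurve, hL₀, polyline_map_range_apply_zero]
  have hF1 : (familyFaceDomain hΛ hadm).pt 1 = g N := by
    rw [← medialExplorationCurve_apply_one_eq hΛ hadm ω, hcurve, hL₀, polyline_map_range_apply_one]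
  have hcl : ∀ i ≤ N, g i ∈ closure (familyFaceDomain hΛ hadm).carrier := fun i hi ↦ by
    have := medialPoint_cSrc_cornerOrbit_mem hadm hΩo hext hunb hfr ω hi; rw [hδE] at this; exact this
  have hseg : ∀ i < N, openSegment ℝ (g i) (g (i + 1)) ⊆ (familyFaceDomain hΛ hadm).carrier := fun i hi ↦ by
    have := openSegment_cornerOrbit_subset_faceDomain hadm hΩo hext hunb hfr ω hi; rw [hδE] at this; exact this
  have hne0 : ∀ i, 0 < i → i ≤ N → g i ≠ (familyFaceDomain hΛ hadm).pt 0 := fun i hi0 hi ↦ by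
    have := medialPoint_cornerOrbit_ne_pt_zero hadm hΩo hext hunb hfr ω hi0 hi; rw [hδE] at this; exact this
  have hne1 : ∀ i < N, g i ≠ (familyFaceDomain hΛ hadm).pt 1 := fun i hi ↦ by
    have := medialPoint_cornerOrbit_ne_pt_one hadm hΩo hext hunb hfr ω hi; rw [hδE] at this; exact this
  have hsucc : ∀ i, g i ≠ g (i + 1) := fun i ↦ by
    have := medialPoint_cornerOrbit_ne_succ hadm ω i; rw [hδE] at this; exact this
  -- list-level forms, symmetric under reversal
  have hmemL : ∀ p ∈ L₀, p ∈ closure (orientedFaceDomain hΛ hadm).carrier := fun p hp ↦ by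
    rw [hL₀, List.mem_map] at hp
    obtain ⟨i, hi, rfl⟩ := hp
    rw [carrier_orientedFaceDomain]
    exact hcl i (Nat.lt_succ_iff.1 (List.mem_range.1 hi))
  have hsegL : ∀ (i : ℕ) (hi : i + 1 < L₀.length),
      openSegment ℝ L₀[i] L₀[i + 1] ⊆ (orientedFaceDomain hΛ hadm).carrier := fun i hi ↦ by
    rw [carrier_orientedFaceDomain, hget, hget]
    exact hseg i (by rw [hlen] at hi; omega)
  have hmarkL : ∀ (i : ℕ) (hi : i + 1 < L₀.length), 0 < i →
      L₀[i] ≠ (familyFaceDomain hΛ hadm).pt 0 ∧ L₀[i] ≠ (familyFaceDomain hΛ hadm).pt 1 := fun i hi hi0 ↦ by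
    rw [hget]; rw [hlen] at hi; exact ⟨hne0 i hi0 (by omega), hne1 i (by omega)⟩
  have hsuccL : ∀ (i : ℕ) (hi : i + 1 < L₀.length), L₀[i] ≠ L₀[i + 1] := fun i hi ↦ by
    rw [hget, hget]; exact hsucc i
  have hhead : L₀.head? = some (g 0) := by
    rw [hL₀, List.range_succ_eq_map, List.map_cons, List.head?_cons]
  have hlast : L₀.getLast? = some (g N) := by
    rw [List.getLast?_eq_getElem?, hlen, Nat.add_sub_cancel,
      List.getElem?_eq_getElem (by rw [hlen]; omega), hget]
  have h2 : 2 ≤ L₀.length := by have := exitTime_pos hadm ω; rw [hlen]; omega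
  -- the endpoint rule
  by_cases hle : dist ((familyFaceDomain hΛ hadm).pt 0) (D.pt 0) ≤
      dist ((familyFaceDomain hΛ hadm).pt 0) (D.pt 1)
  · -- no reversal
    have hO : orientedFaceDomain hΛ hadm = familyFaceDomain hΛ hadm :=
      orientedFaceDomain_of_le hΛ hadm hle
    refine ⟨L₀, h2, ?_, ?_, ?_, hmemL, hsegL, fun i hi hi0 ↦ ?_, hsuccL⟩
    · rw [bondInterfaceIn_eq_mk_orientCurve, hcurve,
        Literature.Probability.Percolation.orientCurve_of_le D]
      rwa [← hcurve, medialExplorationCurve_apply_zero_eq hΛ hadm ω]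
    · rw [hhead, hO, hF0]
    · rw [hlast, hO, hF1]
    · rw [hO]; exact hmarkL i hi hi0
  · -- reversal: the oriented face domain is the swapped one and the list is reversed
    have hO : orientedFaceDomain hΛ hadm = (familyFaceDomain hΛ hadm).swap :=
      orientedFaceDomain_of_not_le hΛ hadm hle
    refine ⟨L₀.reverse, by rwa [List.length_reverse], ?_, ?_, ?_,
      fun p hp ↦ hmemL p (List.mem_reverse.1 hp), fun i hi ↦ ?_, fun i hi hi0 ↦ ?_, fun i hi ↦ ?_⟩
    · rw [bondInterfaceIn_eq_mk_orientCurve, hcurve,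
        Literature.Probability.Percolation.orientCurve_of_lt D, ← Polyline.reverse_mk_polyline,
        CurveClass.reverse_mk]
      · rfl
      · rw [← hcurve, medialExplorationCurve_apply_zero_eq hΛ hadm ω]
        exact lt_of_not_ge hle
    · rw [List.head?_reverse, hlast, hO, MarkedDomain.pt_swap_zero, hF1]
    · rw [List.getLast?_reverse, hhead, hO, MarkedDomain.pt_swap_one, hF0]
    · rw [List.getElem_reverse, List.getElem_reverse, openSegment_symm]
      have hi' : L₀.length - 1 - (i + 1) + 1 = L₀.length - 1 - i := by rw [List.length_reverse] at hi; omega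
      simpa only [hi'] using hsegL (L₀.length - 1 - (i + 1)) (by rw [List.length_reverse] at hi; omega)
    · rw [List.getElem_reverse, hO, MarkedDomain.pt_swap_zero, MarkedDomain.pt_swap_one]
      have key := hmarkL (L₀.length - 1 - i) (by rw [List.length_reverse] at hi; omega)
        (by rw [List.length_reverse] at hi; omega)
      exact ⟨key.2, key.1⟩
    · rw [List.getElem_reverse, List.getElem_reverse]
      have hi' : L₀.length - 1 - (i + 1) + 1 = L₀.length - 1 - i := by rw [List.length_reverse] at hi; omega
      have key := hsuccL (L₀.length - 1 - (i + 1)) (by rw [List.length_reverse] at hi; omega)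
      simp only [hi'] at key
      exact fun h ↦ key h.symm


end Summit.CriticalPhenomena.CardyFormulaZ2.Cruxes.MartingaleToSLE6.Birth

end
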